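import Literature.Geometry.Symplectic.TaubesFamilyUniqueness
import HarnessLib

/-!
# The Taubes solution is unique up to gauge for large `r`

Topic `Literature/Geometry/Symplectic`; the conclusion of Taubes (1995) Theorem 1.3 Step 3 /
Hutchings–Taubes (1999) §4.5 ("If `[ω]·e = 0` then we must have `|α| ≡ 1` and `β ≡ 0` … After a gauge
transformation, `α ≡ 1` … `a ≡ 0`. So this is the only solution") for the tree's family: every
solution `(A, ψ)` of the Seiberg–Witten equations of the canonical Spinᶜ structure `𝔰_J` with
perturbation `P₊F_{A₀} - (r/4)s`, `r = |c|²`, is **gauge equivalent to Taubes's solution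
`(A₀, c·u₀)`** as soon as `r > 16 sup_N |b|²` (`b` Taubes's torsion)
(`gaugeRel_canonicalConfiguration_of_isSolution`).

From `TaubesFamilyUniqueness` (`∇'α ≡ 0` on frames, `|α|² ≡ r`, `β ≡ 0`): `∇'α = dα + iaα = 0` on all
tangent vectors (the frame spans), so `ψ = αu₀` with `|α| = |c|`, and the change of gauge
`σ = conj(α/c) : N → S¹` has `σ̄dσ = α conj(dα)/|c|² = ia` and carries `(A₀, c·u₀)` to
`(A₀ + 2a, αu₀) = (A, ψ)` in the tree's convention `GaugeRel` (`iA' = iA + 2σ̄dσ`, `ψ' = σ̄ψ`).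

PROVED, 0 named facts.

## References

* C. H. Taubes, *The Seiberg–Witten and Gromov invariants*, Math. Res. Lett. 2 (1995) 221–238,
  Thm. 1.3, §5 Step 3. [Taubes1995]
* M. Hutchings, C. H. Taubes, *An introduction to the Seiberg–Witten equations on symplectic
  manifolds*, IAS/Park City Math. Ser. 7 (1999; AMS 2006), §4.5. [HutchingsTaubes2006]
* C. H. Taubes, *The Seiberg–Witten invariants and symplectic forms*, Math. Res. Lett. 1 (1994)
  809–822, Main Theorem. [Taubes1994]
-/

noncomputable section

open scoped Manifold ContDiff Topology ComplexConjugate Matrix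
open Set Function Filter Complex Literature.Geometry.Kaehler Literature.Geometry.GaugeTheory Literature.Topology.FourManifolds
open Literature.Geometry.Lorentzian (PseudoRiemannianMetric)
open Literature.Geometry.Manifold Literature.Geometry.Manifold.DeRhamSignFour Literature.NumberTheory.Transcendental

namespace Literature.Geometry.Symplectic

open Literature.Geometry.GaugeTheory.SpincStructure

namespace AlmostComplexStructure.IsCompatibleWith

variable {N : Type} [TopologicalSpace N] [ChartedSpace (EuclideanSpace ℝ (Fin 4)) N] [IsManifold (𝓡 4) ∞ N]
  [T2Space N] [CompactSpace N]
  {J : AlmostComplexStructure (𝓡 4) ∞ N} {s : MForm (𝓡 4) N ℝ 2}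
  (h : J.IsCompatibleWith s) (hs : IsSmoothForm s)
  (hnd : ∀ x (v : TangentSpace (𝓡 4) x), v ≠ 0 → ∃ w : TangentSpace (𝓡 4) x, s x ![v, w] ≠ 0)
  [(h.metric hs).HasLeviCivita]

/-! ### Consequences of `TaubesFamilyUniqueness` on all tangent vectors and all charts -/

/-- **`∇'α = 0` on every tangent vector** (the unitary frame spans). [cite: HutchingsTaubes2006, §4.5] -/
theorem connDeriv_alphaFun_eq_zero_of_isSolution (hcl : IsClosedForm s) (c : ℂ)
    {cfg : (h.canonicalSpincStructure hs hnd).Configuration}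
    (hsol : SpincStructure.IsSolution (h.taubesPerturbation hs hnd - h.symplecticPerturbation hs hnd (Complex.normSq c / 4)) cfg)
    (hr : 16 * (⨆ y : N, ∑ k, Complex.normSq ((h.unitaryAdaptedFrames hs hnd).canonicalTorsion
        ((h.canonicalSpincStructure hs hnd).indexAt y) y
          ((h.canonicalSpincStructure hs hnd).frame ((h.canonicalSpincStructure hs hnd).indexAt y) k y))) < Complex.normSq c)
    (x : N) (v : TangentSpace (𝓡 4) x) :
    connDeriv (h.alphaFun hs hnd cfg) (h.halfConnectionDiff hs hnd cfg) x v = 0 := by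
  have hk := (h.eq_taubes_of_isSolution hs hnd hcl c hsol hr x).1
  -- `v ↦ ∇'_vα` is `ℝ`-linear (a sum of two continuous linear maps) and vanishes on the frame, which spans
  set L : TangentSpace (𝓡 4) x →L[ℝ] ℂ :=
    (show TangentSpace (𝓡 4) x →L[ℝ] ℂ from mfderiv (𝓡 4) 𝓘(ℝ, ℂ) (h.alphaFun hs hnd cfg) x) +
      (I * h.alphaFun hs hnd cfg x) • (Complex.ofRealCLM.comp (h.halfConnectionDiff hs hnd cfg x)) with hL
  have hLw : ∀ w, L w = connDeriv (h.alphaFun hs hnd cfg) (h.halfConnectionDiff hs hnd cfg) x w := by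
    intro w
    simp only [hL, connDeriv, complexDeriv, _root_.add_apply, FunLike.coe_smul, Pi.smul_apply, ContinuousLinearMap.coe_comp,
      Function.comp_apply, Complex.ofRealCLM_apply, smul_eq_mul]
    change mfderiv (𝓡 4) 𝓘(ℝ, ℂ) (h.alphaFun hs hnd cfg) x w + _ = mfderiv (𝓡 4) 𝓘(ℝ, ℂ) (h.alphaFun hs hnd cfg) x w + _
    ring
  have hmem : v ∈ Submodule.span ℝ (Set.range fun k ↦ (h.canonicalSpincStructure hs hnd).frame ((h.canonicalSpincStructure hs hnd).indexAt x) k x) := by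
    rw [(h.canonicalSpincStructure hs hnd).span_frame_eq_top _ ((h.canonicalSpincStructure hs hnd).mem_baseSet_indexAt x)]
    trivial
  have hLv : L v = 0 := by
    refine Submodule.span_induction (p := fun w _ ↦ L w = 0) ?_ (map_zero L) (fun w w' _ _ hw hw' ↦ by rw [map_add, hw, hw', add_zero])
      (fun t w _ hw ↦ by rw [map_smul, hw, smul_zero]) hmem
    rintro _ ⟨k, rfl⟩
    rw [hLw]
    exact hk k
  rw [← hLw, hLv]

/-- **`dα = -iaα`.** [cite: HutchingsTaubes2006, §4.5] -/
theorem complexDeriv_alphaFun_eq_of_isSolution (hcl : IsClosedForm s) (c : ℂ)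
    {cfg : (h.canonicalSpincStructure hs hnd).Configuration}
    (hsol : SpincStructure.IsSolution (h.taubesPerturbation hs hnd - h.symplecticPerturbation hs hnd (Complex.normSq c / 4)) cfg)
    (hr : 16 * (⨆ y : N, ∑ k, Complex.normSq ((h.unitaryAdaptedFrames hs hnd).canonicalTorsion
        ((h.canonicalSpincStructure hs hnd).indexAt y) y
          ((h.canonicalSpincStructure hs hnd).frame ((h.canonicalSpincStructure hs hnd).indexAt y) k y))) < Complex.normSq c)
    (x : N) (v : TangentSpace (𝓡 4) x) :
    complexDeriv (h.alphaFun hs hnd cfg) x v = -(I * ((h.halfConnectionDiff hs hnd cfg x v : ℝ) : ℂ) * h.alphaFun hs hnd cfg x) := by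
  have h0 := h.connDeriv_alphaFun_eq_zero_of_isSolution hs hnd hcl c hsol hr x v
  rw [connDeriv] at h0
  linear_combination h0

/-- **`β = 0` on every chart** (as a local spinor). [cite: HutchingsTaubes2006, §4.5] -/
theorem betaField_toFun_eq_zero_of_isSolution (hcl : IsClosedForm s) (c : ℂ)
    {cfg : (h.canonicalSpincStructure hs hnd).Configuration}
    (hsol : SpincStructure.IsSolution (h.taubesPerturbation hs hnd - h.symplecticPerturbation hs hnd (Complex.normSq c / 4)) cfg)
    (hr : 16 * (⨆ y : N, ∑ k, Complex.normSq ((h.unitaryAdaptedFrames hs hnd).canonicalTorsion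
        ((h.canonicalSpincStructure hs hnd).indexAt y) y
          ((h.canonicalSpincStructure hs hnd).frame ((h.canonicalSpincStructure hs hnd).indexAt y) k y))) < Complex.normSq c)
    (i : N) {x : N} (hx : x ∈ (h.canonicalSpincStructure hs hnd).baseSet i) :
    (h.betaField hs hnd cfg).toFun i x = 0 := by
  have hb := (h.eq_taubes_of_isSolution hs hnd hcl c hsol hr x).2.2
  rw [h.betaSq_eq hs hnd cfg i hx, Complex.normSq_eq_zero] at hb
  rw [h.betaField_toFun_eq_sumElim hs hnd cfg i hx, hb]
  funext a
  rcases a with a | a <;> fin_cases a <;> simp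

/-- **`ψ = αu₀` on every chart.** [cite: HutchingsTaubes2006, §4.5] -/
theorem spinor_toFun_eq_of_isSolution (hcl : IsClosedForm s) (c : ℂ)
    {cfg : (h.canonicalSpincStructure hs hnd).Configuration}
    (hsol : SpincStructure.IsSolution (h.taubesPerturbation hs hnd - h.symplecticPerturbation hs hnd (Complex.normSq c / 4)) cfg)
    (hr : 16 * (⨆ y : N, ∑ k, Complex.normSq ((h.unitaryAdaptedFrames hs hnd).canonicalTorsion
        ((h.canonicalSpincStructure hs hnd).indexAt y) y
          ((h.canonicalSpincStructure hs hnd).frame ((h.canonicalSpincStructure hs hnd).indexAt y) k y))) < Complex.normSq c)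
    (i : N) {x : N} (hx : x ∈ (h.canonicalSpincStructure hs hnd).baseSet i) :
    cfg.spinor.toFun i x = h.alphaFun hs hnd cfg x • plusUnit := by
  have hψ := congrArg (fun ψ : SpinorField (h.canonicalSpincStructure hs hnd) ↦ ψ.toFun i x)
    (h.spinor_eq_smul_canonicalSpinor_add_betaField hs hnd cfg)
  simp only [SpinorField.add_toFun, SpinorField.smulFun_toFun, canonicalSpinor_toFun,
    h.betaField_toFun_eq_zero_of_isSolution hs hnd hcl c hsol hr i hx, add_zero] at hψ
  exact hψ

/-! ### The change of gauge `σ = conj(α/c)` -/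

/-- **The change of gauge `σ = conj(α/c) : N → S¹`** carrying Taubes's solution to the given one
(`|α| = |c| ≠ 0`). [cite: HutchingsTaubes2006, §4.5] -/
def taubesGauge (hcl : IsClosedForm s) (c : ℂ)
    {cfg : (h.canonicalSpincStructure hs hnd).Configuration}
    (hsol : SpincStructure.IsSolution (h.taubesPerturbation hs hnd - h.symplecticPerturbation hs hnd (Complex.normSq c / 4)) cfg)
    (hr : 16 * (⨆ y : N, ∑ k, Complex.normSq ((h.unitaryAdaptedFrames hs hnd).canonicalTorsion
        ((h.canonicalSpincStructure hs hnd).indexAt y) y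
          ((h.canonicalSpincStructure hs hnd).frame ((h.canonicalSpincStructure hs hnd).indexAt y) k y))) < Complex.normSq c) :
    SpincGauge N where
  toFun x := conj (h.alphaFun hs hnd cfg x / c)
  norm_toFun x := by
    have ha := (h.eq_taubes_of_isSolution hs hnd hcl c hsol hr x).2.1
    have hT0 : 0 ≤ ⨆ y : N, ∑ k, Complex.normSq ((h.unitaryAdaptedFrames hs hnd).canonicalTorsion
        ((h.canonicalSpincStructure hs hnd).indexAt y) y
          ((h.canonicalSpincStructure hs hnd).frame ((h.canonicalSpincStructure hs hnd).indexAt y) k y)) :=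
      (Finset.sum_nonneg fun k _ ↦ Complex.normSq_nonneg _).trans (le_ciSup (h.bddAbove_range_sum_normSq_canonicalTorsion hs hnd) x)
    have hc : c ≠ 0 := fun h0 ↦ by rw [h0, map_zero] at hr; linarith
    have hn : ‖h.alphaFun hs hnd cfg x‖ = ‖c‖ := by
      rw [← Real.sqrt_sq (norm_nonneg (h.alphaFun hs hnd cfg x)), ← Real.sqrt_sq (norm_nonneg c),
        ← Complex.normSq_eq_norm_sq, ← Complex.normSq_eq_norm_sq]
      exact congrArg Real.sqrt ha
    rw [Complex.norm_conj, norm_div, hn, div_self (norm_ne_zero_iff.2 hc)]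
  contMDiff_toFun := by
    have h1 : ContMDiff (𝓡 4) 𝓘(ℝ, ℂ) ∞ (fun y ↦ h.alphaFun hs hnd cfg y / c) := fun y ↦ by
      simpa [div_eq_mul_inv] using ContMDiffAt.mul_complex ((h.contMDiff_alphaFun hs hnd cfg) y) (contMDiffAt_const (c := c⁻¹))
    exact (Complex.conjCLE : ℂ ≃L[ℝ] ℂ).contDiff.comp_contMDiff h1

/-- The map underlying `σ` (definitional). [folklore] -/
@[simp] theorem taubesGauge_toFun (hcl : IsClosedForm s) (c : ℂ)
    {cfg : (h.canonicalSpincStructure hs hnd).Configuration}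
    (hsol : SpincStructure.IsSolution (h.taubesPerturbation hs hnd - h.symplecticPerturbation hs hnd (Complex.normSq c / 4)) cfg)
    (hr : 16 * (⨆ y : N, ∑ k, Complex.normSq ((h.unitaryAdaptedFrames hs hnd).canonicalTorsion
        ((h.canonicalSpincStructure hs hnd).indexAt y) y
          ((h.canonicalSpincStructure hs hnd).frame ((h.canonicalSpincStructure hs hnd).indexAt y) k y))) < Complex.normSq c) (x : N) :
    (h.taubesGauge hs hnd hcl c hsol hr).toFun x = conj (h.alphaFun hs hnd cfg x / c) := rfl

/-! ### Uniqueness up to gauge -/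

/-- **Taubes's solution is the only one up to gauge, for `r` large** (Taubes 1995, Thm. 1.3 Step 3;
Hutchings–Taubes §4.5; Taubes 1994, Main Theorem, uniqueness): every solution `(A, ψ)` of the
Seiberg–Witten equations of `𝔰_J` with perturbation `P₊F_{A₀} - (r/4)s`, `r = |c|² > 16 sup_N|b|²`,
is gauge equivalent to `(A₀, c·u₀)` — via `σ = conj(α/c)`: `iA = iA₀ + 2σ̄dσ`, `ψ = σ̄·(c u₀)`.
[cite: Taubes1995, Thm. 1.3, §5 Step 3] [cite: HutchingsTaubes2006, §4.5 (4.19)] [cite: Taubes1994, Main Theorem] -/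
theorem gaugeRel_canonicalConfiguration_of_isSolution (hcl : IsClosedForm s) (c : ℂ)
    {cfg : (h.canonicalSpincStructure hs hnd).Configuration}
    (hsol : SpincStructure.IsSolution (h.taubesPerturbation hs hnd - h.symplecticPerturbation hs hnd (Complex.normSq c / 4)) cfg)
    (hr : 16 * (⨆ y : N, ∑ k, Complex.normSq ((h.unitaryAdaptedFrames hs hnd).canonicalTorsion
        ((h.canonicalSpincStructure hs hnd).indexAt y) y
          ((h.canonicalSpincStructure hs hnd).frame ((h.canonicalSpincStructure hs hnd).indexAt y) k y))) < Complex.normSq c) :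
    GaugeRel (h.canonicalConfiguration hs hnd (h.taubesConnection hs hnd) c) cfg := by
  have hT0 : 0 ≤ (⨆ y : N, ∑ k, Complex.normSq ((h.unitaryAdaptedFrames hs hnd).canonicalTorsion
        ((h.canonicalSpincStructure hs hnd).indexAt y) y
          ((h.canonicalSpincStructure hs hnd).frame ((h.canonicalSpincStructure hs hnd).indexAt y) k y))) :=
    Real.iSup_nonneg fun y ↦ Finset.sum_nonneg fun k _ ↦ Complex.normSq_nonneg _
  have hr0 : 0 < Complex.normSq c := by nlinarith
  have hc : c ≠ 0 := fun h0 ↦ by rw [h0, map_zero] at hr0; exact lt_irrefl _ hr0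
  refine ⟨h.taubesGauge hs hnd hcl c hsol hr, fun i x hx v ↦ ?_, fun i x hx ↦ ?_⟩
  · -- the connections: `iA = iA₀ + 2σ̄dσ`, `σ̄dσ = ia`
    have hform : cfg.conn.form i x v = (h.taubesConnection hs hnd).form i x v + 2 * h.halfConnectionDiff hs hnd cfg x v := by
      rw [h.conn_form_eq hs hnd cfg i hx]
      simp [CircleCocycle.Connection.addForm]
    have hα := ((h.contMDiff_alphaFun hs hnd cfg) x).mdifferentiableAt (by simp)
    have hαc : MDifferentiableAt (𝓡 4) 𝓘(ℝ, ℂ) (fun y ↦ h.alphaFun hs hnd cfg y / c) x := by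
      have : (fun y ↦ h.alphaFun hs hnd cfg y / c) = fun y ↦ c⁻¹ * h.alphaFun hs hnd cfg y := by funext y; ring
      rw [this]; exact (mdifferentiableAt_const).mul hα
    have hd : complexDeriv (fun y ↦ h.alphaFun hs hnd cfg y / c) x v = c⁻¹ * complexDeriv (h.alphaFun hs hnd cfg) x v := by
      have : (fun y ↦ h.alphaFun hs hnd cfg y / c) = fun y ↦ c⁻¹ * h.alphaFun hs hnd cfg y := by funext y; ring
      rw [this, complexDeriv_const_mul _ hα]
    have ha := (h.eq_taubes_of_isSolution hs hnd hcl c hsol hr x).2.1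
    rw [alphaSq, ← h.alphaFun_eq hs hnd cfg _ ((h.canonicalSpincStructure hs hnd).mem_baseSet_indexAt x)] at ha
    change Complex.normSq (h.alphaFun hs hnd cfg x) = Complex.normSq c at ha
    rw [SpincGauge.logDeriv, taubesGauge_toFun,
      show (h.taubesGauge hs hnd hcl c hsol hr).toFun = fun y ↦ conj (h.alphaFun hs hnd cfg y / c) from rfl,
      complexDeriv_conj_fun hαc, hd,
      h.complexDeriv_alphaFun_eq_of_isSolution hs hnd hcl c hsol hr x v, canonicalConfiguration_conn, hform]
    -- `(α/c)·conj(c⁻¹·(-iaα)) = ia|α|²/|c|² = ia`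
    have hnc : (Complex.normSq c : ℂ) ≠ 0 := by exact_mod_cast hr0.ne'
    have hkey : (starRingEnd ℂ) ((starRingEnd ℂ) (h.alphaFun hs hnd cfg x / c)) *
        (starRingEnd ℂ) (c⁻¹ * -(I * ((h.halfConnectionDiff hs hnd cfg x v : ℝ) : ℂ) * h.alphaFun hs hnd cfg x)) =
        I * ((h.halfConnectionDiff hs hnd cfg x v : ℝ) : ℂ) := by
      simp only [map_mul, map_neg, map_inv₀, map_div₀, Complex.conj_conj, Complex.conj_I, Complex.conj_ofReal]
      calc h.alphaFun hs hnd cfg x / c * (((starRingEnd ℂ) c)⁻¹ * -(-I * ((h.halfConnectionDiff hs hnd cfg x v : ℝ) : ℂ) * (starRingEnd ℂ) (h.alphaFun hs hnd cfg x)))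
          = (h.alphaFun hs hnd cfg x * (starRingEnd ℂ) (h.alphaFun hs hnd cfg x)) * (c⁻¹ * ((starRingEnd ℂ) c)⁻¹) *
              (I * ((h.halfConnectionDiff hs hnd cfg x v : ℝ) : ℂ)) := by
            rw [div_eq_mul_inv]; ring
        _ = I * ((h.halfConnectionDiff hs hnd cfg x v : ℝ) : ℂ) := by
            rw [Complex.mul_conj, ← mul_inv, Complex.mul_conj, ha, mul_inv_cancel₀ hnc, one_mul]
    rw [hkey]
    push_cast
    ring
  · -- the spinors: `ψ = σ̄·(c u₀) = αu₀`
    rw [h.spinor_toFun_eq_of_isSolution hs hnd hcl c hsol hr i hx, taubesGauge_toFun, canonicalConfiguration_spinor_toFun,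
      Complex.conj_conj, smul_smul, div_mul_cancel₀ _ hc]

/-- **The moduli space of `(SW_r)` is the single gauge orbit of Taubes's solution** for
`r = |c|² > 16 sup_N|b|²`: a configuration of `𝔰_J` solves the Seiberg–Witten equations with
perturbation `P₊F_{A₀} - (r/4)s` iff it is gauge equivalent to `(A₀, c·u₀)` (Taubes 1995, Thm. 1.3:
"`SW(K⁻¹) = ±1`" at the level of solutions; the sign/count needs the transversality not treated here).
[cite: Taubes1995, Thm. 1.3, §5 Steps 1, 3] [cite: Taubes1994, Main Theorem] -/
theorem isSolution_iff_gaugeRel_canonicalConfiguration (hcl : IsClosedForm s) (c : ℂ)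
    (hr : 16 * (⨆ y : N, ∑ k, Complex.normSq ((h.unitaryAdaptedFrames hs hnd).canonicalTorsion
        ((h.canonicalSpincStructure hs hnd).indexAt y) y
          ((h.canonicalSpincStructure hs hnd).frame ((h.canonicalSpincStructure hs hnd).indexAt y) k y))) < Complex.normSq c) (cfg : (h.canonicalSpincStructure hs hnd).Configuration) :
    SpincStructure.IsSolution (h.taubesPerturbation hs hnd - h.symplecticPerturbation hs hnd (Complex.normSq c / 4)) cfg ↔
      GaugeRel (h.canonicalConfiguration hs hnd (h.taubesConnection hs hnd) c) cfg :=
  ⟨fun hsol ↦ h.gaugeRel_canonicalConfiguration_of_isSolution hs hnd hcl c hsol hr, fun hg ↦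
    (isSolution_iff_of_gaugeRel _ hg).2 (h.isSolution_canonicalConfiguration_taubes hs hnd hcl c)⟩

end AlmostComplexStructure.IsCompatibleWith

end Literature.Geometry.Symplectic

end
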